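import Summits.CriticalPhenomena.PercolationContinuityZ3.Theorems.PercMinContactTwoArmWindowSmallLevel
import Summits.CriticalPhenomena.PercolationContinuityZ3.Theorems.PercMinContactTwoArmWindowHalf
import HarnessLib

/-!
# `twoArm_clauseA_half` — clause (a) of `TwoArmWindow` with `λ = 1/2`, unconditionally, at EVERY level

Crux `Summit.CriticalPhenomena.PercolationContinuityZ3.Theses.PercMinContact.TwoArmWindow`
(item stmt-CriticalPhenomena-11499), line `registered`, lead prover-line-stmt-CriticalPhenomena-11499-c2-0,
registered sub-goal `twoArm_clauseA_half` (`--supports stmt-CriticalPhenomena-11499`).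

The crux asks for `λ, Δ₀` with `Δ₀ (1 - λ) < 1` such that (a) the p-UNIFORM VOLUME TWO-ARM bound
`Σ_{y ∼ 0} P_u(|C(0)| ≥ n, |C(y)| ≥ n, 0 ↮ y) ≤ C n^{-λ}` holds for all `u < p_c`, `n ≥ 1`, and (b) a
subcritical volume window with gap exponent `Δ₀`.  This file records the RIGOROUS STATE OF CLAUSE (a):
it holds with **`λ = 1/2` at every level `u ∈ [0, 1]`** (not only `u < p_c`), with one constant —
the glue of the two landed pieces of the line:

* `stub_twoArmSmallLevel` (levels `u ≤ 1/5`, exponent `1`; Markov + path counting, p146056), and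
* `twoArm_half` (levels `u > 1/5`, exponent `1/2`; Hutchcroft's two-ghost inequality
  arXiv:1808.08940 Cor. 1.7 + a.s. uniqueness of the infinite cluster, p145214),

using `n^{-1} ≤ n^{-1/2}` for `n ≥ 1`.  With `λ = 1/2` the budget would need a window `Δ₀ < 2`,
below the true gap exponent `Δ = 1/σ ≈ 2.21` of `ℤ³`; the line therefore keeps the open core
`stub_volumeTwoArmCore` (`λ ≥ 3/5` on `1/5 < u < p_c`).  Nothing here is new mathematics beyond the
two-ghost inequality; the point is the exact crux-shaped statement, quantified over all levels.
-/

noncomputable section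

namespace Summit.CriticalPhenomena.PercolationContinuityZ3.Theorems

open MeasureTheory Literature.Probability.Percolation Literature.Probability.LatticeModels

/-- **Clause (a) of `TwoArmWindow` at `λ = 1/2`, all levels.**  There is `C` such that for every
`u : unitInterval` and every `n ≥ 1`,
`Σ_{y ∼ 0} P_u(|C(0)| ≥ n ∧ |C(y)| ≥ n ∧ 0 ↮ y) ≤ C · n^{-1/2}` — the levels `u ≤ 1/5` by
`stub_twoArmSmallLevel` (exponent `1 ≥ 1/2`), the levels `u > 1/5` by `twoArm_half` (two-ghost). -/
theorem twoArm_clauseA_half :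
    ∃ C : ℝ, ∀ u : unitInterval, ∀ n : ℕ, 1 ≤ n →
      ∑ y ∈ (zdGraph 3).neighborFinset (0 : Site 3),
        (bondPercolation (zdGraph 3) u).real
          {ω | (n : ℕ∞) ≤ (openCluster ω 0).encard ∧ (n : ℕ∞) ≤ (openCluster ω y).encard ∧
            ¬ (openGraph ω).Reachable 0 y} ≤ C * (n : ℝ) ^ (-(1 / 2 : ℝ)) := by
  obtain ⟨C₁, h₁⟩ := stub_twoArmSmallLevel
  obtain ⟨C₂, h₂⟩ := twoArm_half
  refine ⟨max (max C₁ C₂) 0, fun u n hn => ?_⟩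
  have hn' : (1 : ℝ) ≤ (n : ℝ) := by exact_mod_cast hn
  have hC0 : 0 ≤ max (max C₁ C₂) 0 := le_max_right _ _
  have hrpow : 0 ≤ (n : ℝ) ^ (-(1 / 2 : ℝ)) := Real.rpow_nonneg (Nat.cast_nonneg n) _
  by_cases hsmall : (u : ℝ) ≤ 1 / 5
  · calc _ ≤ C₁ * (n : ℝ) ^ (-(1 : ℝ)) := h₁ u hsmall n hn
      _ ≤ max (max C₁ C₂) 0 * (n : ℝ) ^ (-(1 : ℝ)) :=
          mul_le_mul_of_nonneg_right ((le_max_left _ _).trans (le_max_left _ _))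
            (Real.rpow_nonneg (Nat.cast_nonneg n) _)
      _ ≤ max (max C₁ C₂) 0 * (n : ℝ) ^ (-(1 / 2 : ℝ)) :=
          mul_le_mul_of_nonneg_left (Real.rpow_le_rpow_of_exponent_le hn' (by norm_num)) hC0
  · calc _ ≤ C₂ * (n : ℝ) ^ (-(1 / 2 : ℝ)) := h₂ u (not_le.mp hsmall) n hn
      _ ≤ max (max C₁ C₂) 0 * (n : ℝ) ^ (-(1 / 2 : ℝ)) :=
          mul_le_mul_of_nonneg_right ((le_max_right _ _).trans (le_max_left _ _)) hrpow

end Summit.CriticalPhenomena.PercolationContinuityZ3.Theorems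

end
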